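import Literature.NumberTheory.PAdicHodge.AinfGaloisContinuity
import Literature.NumberTheory.PAdicHodge.BdRPlusEmbedding
import Literature.NumberTheory.GaloisRepresentations.AbsGaloisGroup
import Mathlib.Topology.MetricSpace.Pseudo.Lemmas
import HarnessLib

/-!
# Continuity of the `Γ_F`-action on `B_dR⁺(F)` for Fontaine's topology (lattices `p^N 𝔸_inf + ξ^k B_dR⁺`)

Topic `Literature/NumberTheory/PAdicHodge`; THEOREMS ONLY (no definition, no named fact, no instance,
no `sorry`). Sequel to `AinfGaloisContinuity`. Fontaine (*Le corps des périodes p-adiques*, Exp. II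
§1.5.3–1.5.5) and Kato (LNM 1553, II §1.2.5) topologise `B_dR⁺/Fil^k B_dR⁺ = (𝔸_inf/ξ^k)[1/p]` as a
`ℚ_p`-Banach space whose unit ball is the image of `𝔸_inf/ξ^k`, i.e. `B_dR⁺` carries the linear topology
with the fundamental system of neighbourhoods of `0`

  `Λ(N, k) = p^N · ι(𝔸_inf) + ξ^k · B_dR⁺`  (`ι : 𝔸_inf → B_dR⁺`, `N k : ℕ`),

and the action of `Γ_F` is continuous for it. This file proves that statement WITHOUT introducing a
topology (def-free, membership in `Λ(N,k)` displayed as `∃ a w, x = ι(p^N a) + ξ^k w`):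

* §1 `exists_natCast_pow_mul_eq_ainfToBdR_add` — **every `b ∈ B_dR⁺` is bounded**: `p^r b ∈ ι(𝔸_inf) + ξ^k B_dR⁺`
  for some `r` (`B_dR⁺/ξ^k = 𝔸_inf[1/p]/ξ^k`);
* §2 `exists_eq_of_xiBdR_mul_eq` — **division by `ξ`**: `ξ y ∈ ι(a) + ξ^{k+1} B_dR⁺ ⇒ a = ξ a'`, `y ∈ ι(a') + ξ^k B_dR⁺`
  (`ker θ ∩ 𝔸_inf = ξ 𝔸_inf`, `𝒪_{ℂ_F}` is `p`-torsion free);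
* §3 `exists_openSubgroup_galBdRPlus_sub_mem` (**main**) — for `b ∈ B_dR⁺` and `N k` there is an open
  subgroup `U ≤ Γ_F` with `τ b − b ∈ Λ(N, k)` for all `τ ∈ U` (from the `𝔸_inf` statement
  `GaloisContinuity.exists_openSubgroup_galAinf_sub_mem_span` and §1);
* §4 `norm_thetaBdR_le_of_eq` — `θ(Λ(N, k)) ⊆ p^N 𝒪_{ℂ_F}` (`k ≥ 1`): the lattices are `θ`-small;
* §5 scalar tools: continuous maps `Γ_F → X` (metric) are uniformly continuous along open subgroups
  (`exists_openSubgroup_dist_lt`, compactness of `Γ_F`), and `‖x‖ ≤ p^{-n} ⇒ x ∈ p^n ℤ_p` in `ℚ_p`.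

These are the inputs of the continuity predicate on cochains `Γ_F → B_dR⁺` used for Kato's `t`-adic
dévissage of `H¹(K, B_dR^m)` (tree `TateGradedDevissage`, hypothesis `hstep`). BSD is not proved here.

## References
* J.-M. Fontaine, *Le corps des périodes p-adiques*, Astérisque 223 (1994), Exp. II §1.5.3–1.5.5. [FontaineAsterisque223III]
* K. Kato, LNM 1553 (1993), Ch. II §1.2.5. [Kato1993LNM1553]
* J.-M. Fontaine, Y. Ouyang, *Theory of p-adic Galois representations*, §5.2. [FontaineOuyang2022]
-/

noncomputable section

open ValuativeRel Field Ideal WittVector Topology Filter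

namespace Literature.NumberTheory.PAdicHodge

open Literature.NumberTheory.GaloisRepresentations
open Literature.NumberTheory.GaloisRepresentations.IsNonarchimedeanLocalField

namespace GaloisContinuity

variable {F : Type} [Field F] [ValuativeRel F] [TopologicalSpace F] [IsNonarchimedeanLocalField F]
  [CharZero F] {p : ℕ} [Fact p.Prime] [Fact (¬ IsUnit (p : integerC F))]
  [IsAdicComplete (Ideal.span {(p : integerC F)}) (integerC F)]

/-! ## §1 Boundedness: `p^r b ∈ ι(𝔸_inf) + ξ^k B_dR⁺` -/

set_option maxHeartbeats 400000 in
/-- **Every element of `B_dR⁺` is bounded for Fontaine's topology**: for `b ∈ B_dR⁺(F)` and `k` there are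
`r`, `a ∈ 𝔸_inf` and `w` with `p^r b = ι(a) + ξ^k w` — i.e. `B_dR⁺/ξ^k B_dR⁺ = (𝔸_inf/ξ^k)[1/p]`
(`B_dR⁺` is the `ker θ`-adic completion of `𝔸_inf[1/p]`).
[cite: FontaineAsterisque223III, Exp. II §1.5.3 (B_dR⁺/Fil^k = lim, structure of (A_inf/ξ^k)[1/p])] [cite: Kato1993LNM1553, Ch. II §1.2.5] -/
theorem exists_natCast_pow_mul_eq_ainfToBdR_add (b : BDeRhamPlus (integerC F) p) (k : ℕ) :
    ∃ (r : ℕ) (a : Ainf (p := p) F) (w : BDeRhamPlus (integerC F) p),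
      (p : BDeRhamPlus (integerC F) p) ^ r * b = ainfToBdR a + xiBdR ^ k * w := by
  set I := RingHom.ker (fontaineThetaInvertP (integerC F) p) with hI
  -- in Mathlib's adic completion: `x − of(z) ∈ ξ^k` for a lift `z` of `eval_k x`
  have key : ∀ x : AdicCompletion I (Localization.Away (p : Ainf (p := p) F)),
      ∃ (z : Localization.Away (p : Ainf (p := p) F)) (w : AdicCompletion I (Localization.Away (p : Ainf (p := p) F))),
        x - AdicCompletion.of I _ z =
          PrincipalCompletion.xiHat I (algebraMap (Ainf (p := p) F) (Localization.Away (p : Ainf (p := p) F)) xi) ^ k * w := by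
    intro x
    obtain ⟨z, hz⟩ := Ideal.Quotient.mk_surjective (AdicCompletion.evalₐ I k x)
    have h0 : AdicCompletion.evalₐ I k (x - AdicCompletion.of I _ z) = 0 := by
      rw [map_sub, AdicCompletion.evalₐ_of, hz, sub_self]
    exact ⟨z, (PrincipalCompletion.evalₐ_eq_zero_iff ker_fontaineThetaInvertP_eq_span _ k).1 h0⟩
  obtain ⟨z, w₀, hw₀⟩ := key b
  let w : BDeRhamPlus (integerC F) p := w₀
  have hw : b - algebraMap (Localization.Away (p : Ainf (p := p) F)) (BDeRhamPlus (integerC F) p) z =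
      xiBdR ^ k * w := hw₀
  obtain ⟨r, a, hra⟩ := IsLocalization.Away.surj (p : Ainf (p := p) F) z
  refine ⟨r, a, (p : BDeRhamPlus (integerC F) p) ^ r * w, ?_⟩
  have h1 : algebraMap (Localization.Away (p : Ainf (p := p) F)) (BDeRhamPlus (integerC F) p) z *
      (p : BDeRhamPlus (integerC F) p) ^ r = ainfToBdR a := by
    have h2 := congrArg (algebraMap (Localization.Away (p : Ainf (p := p) F)) (BDeRhamPlus (integerC F) p)) hra
    rw [map_mul, map_pow, map_natCast, map_natCast] at h2
    exact h2
  have hb : b = algebraMap (Localization.Away (p : Ainf (p := p) F)) (BDeRhamPlus (integerC F) p) z +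
      xiBdR ^ k * w := by
    rw [← sub_eq_iff_eq_add']; exact hw
  rw [hb, mul_add, mul_comm _ (algebraMap _ _ z), h1]
  ring

omit [CharZero F] in
/-- `p` is a unit of `B_dR⁺`, so is `p^r`; a left inverse. [folklore] -/
private theorem exists_mul_natCast_pow_eq_one (r : ℕ) :
    ∃ q : BDeRhamPlus (integerC F) p, q * (p : BDeRhamPlus (integerC F) p) ^ r = 1 := by
  have h := isUnit_ainfToBdR_natCast (F := F) (p := p)
  rw [map_natCast] at h
  exact (h.pow r).exists_left_inv

/-! ## §2 Division by `ξ` inside the lattices -/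

/-- **Division by `ξ`**: if `ξ y = ι(a) + ξ^{k+1} w` in `B_dR⁺` (`a ∈ 𝔸_inf`) then `θ(a) = 0`, so `a = ξ a'`
(`ker θ = ξ 𝔸_inf`), and `y = ι(a') + ξ^k w` (`ξ` is a non-zero-divisor of `B_dR⁺`). In lattice terms:
`ξ B_dR⁺ ∩ Λ(N, k+1) = ξ · Λ(N, k)` — multiplication by `ξ` is a homeomorphism onto its (closed) image.
[cite: FontaineAsterisque223III, Exp. II §1.5.3–1.5.5] [cite: FontaineOuyang2022, Prop. 4.4.3] -/
theorem exists_eq_of_xiBdR_mul_eq {y w : BDeRhamPlus (integerC F) p} {a : Ainf (p := p) F} {k : ℕ}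
    (h : xiBdR * y = ainfToBdR a + xiBdR ^ (k + 1) * w) :
    ∃ a' : Ainf (p := p) F, a = xi * a' ∧ y = ainfToBdR a' + xiBdR ^ k * w := by
  have hθ : fontaineTheta (integerC F) p a = 0 := by
    have h1 : thetaBdR (ainfToBdR a) = 0 := by
      have h2 : ainfToBdR a = xiBdR * y - xiBdR ^ (k + 1) * w := by rw [h]; ring
      rw [h2, map_sub, map_mul, map_mul, map_pow, thetaBdR_xiBdR, zero_mul, zero_pow (Nat.succ_ne_zero k),
        zero_mul, sub_zero]
    rw [thetaBdR_ainfToBdR] at h1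
    exact_mod_cast h1
  obtain ⟨a', rfl⟩ := xi_dvd_of_fontaineTheta_eq_zero hθ
  refine ⟨a', rfl, ?_⟩
  have h2 : xiBdR * (y - (ainfToBdR a' + xiBdR ^ k * w)) = 0 := by
    rw [mul_sub, h, map_mul, ainfToBdR_xi]; ring
  exact sub_eq_zero.1 (eq_zero_of_xiBdR_mul_eq_zero h2)

/-- Division by `ξ` for a lattice element with the `p^N`-scaling displayed. [cite: FontaineAsterisque223III, Exp. II §1.5.3–1.5.5] -/
theorem exists_eq_of_xiBdR_mul_eq_natCast_pow {y w : BDeRhamPlus (integerC F) p} {a : Ainf (p := p) F} {N k : ℕ}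
    (h : xiBdR * y = ainfToBdR ((p : Ainf (p := p) F) ^ N * a) + xiBdR ^ (k + 1) * w) :
    ∃ (a' : Ainf (p := p) F) (w' : BDeRhamPlus (integerC F) p),
      y = ainfToBdR ((p : Ainf (p := p) F) ^ N * a') + xiBdR ^ k * w' := by
  obtain ⟨a₁, ha₁, hy⟩ := exists_eq_of_xiBdR_mul_eq h
  -- `p^N a = ξ a₁`: `θ(a) = 0` too (`𝒪_{ℂ_F}` has no `p`-torsion), so `a = ξ a'` and `a₁ = p^N a'`
  have hθa : fontaineTheta (integerC F) p a = 0 := by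
    have h1 : (p : integerC F) ^ N * fontaineTheta (integerC F) p a = 0 := by
      rw [← map_natCast (fontaineTheta (integerC F) p), ← map_pow, ← map_mul, ha₁, map_mul, fontaineTheta_xi,
        zero_mul]
    clear h hy ha₁
    induction N with
    | zero => rwa [pow_zero, one_mul] at h1
    | succ N ih => rw [pow_succ', mul_assoc] at h1; exact ih (eq_zero_of_natCast_mul_eq_zero h1)
  obtain ⟨a', rfl⟩ := xi_dvd_of_fontaineTheta_eq_zero hθa
  have ha' : a₁ = (p : Ainf (p := p) F) ^ N * a' :=
    mul_left_cancel₀ xi_ne_zero (by rw [← ha₁]; ring)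
  exact ⟨a', w, by rw [hy, ha']⟩

/-! ## §3 Continuity of the `Γ_F`-action on `B_dR⁺` -/

/-- `σ(ξ^k w) ∈ ξ^k B_dR⁺` (`Γ_F` preserves `(ξ) = ker θ`). [cite: FontaineAsterisque223III, Exp. II §1.5.2] -/
theorem exists_galBdRPlus_xiBdR_pow_mul (σ : absoluteGaloisGroup F) (k : ℕ) (w : BDeRhamPlus (integerC F) p) :
    ∃ w' : BDeRhamPlus (integerC F) p, galBdRPlus σ (xiBdR ^ k * w) = xiBdR ^ k * w' := by
  obtain ⟨d, hd⟩ := Ideal.mem_span_singleton'.1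
    (galBdRPlus_mem_span σ (Ideal.mem_span_singleton_self (xiBdR : BDeRhamPlus (integerC F) p)))
  refine ⟨d ^ k * galBdRPlus σ w, ?_⟩
  rw [map_mul, map_pow, ← hd]
  ring

/-- **Continuity of the `Γ_F`-action on `B_dR⁺(F)` for Fontaine's topology (in the group variable).** For
`b ∈ B_dR⁺(F)` and `N k : ℕ` there is an open subgroup `U ≤ Γ_F` such that for all `τ ∈ U`,
`τ b − b = ι(p^N a) + ξ^k w` for some `a ∈ 𝔸_inf`, `w ∈ B_dR⁺`, i.e. `τ b − b ∈ p^N ι(𝔸_inf) + ξ^k B_dR⁺`.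
Proof: `p^r b = ι(a₀) + ξ^k w₀` (§1), `τ a₀ − a₀ ∈ (ξ^k, p^{N+r})` on an open subgroup
(`AinfGaloisContinuity`), and `p` is a unit of `B_dR⁺`.
[cite: FontaineAsterisque223III, Exp. II §1.5.3–1.5.5 (topologie de B_dR⁺, action continue de G_K)] [cite: Kato1993LNM1553, Ch. II §1.2.5] -/
theorem exists_openSubgroup_galBdRPlus_sub_mem (b : BDeRhamPlus (integerC F) p) (N k : ℕ) :
    ∃ U : OpenSubgroup (absoluteGaloisGroup F), ∀ τ ∈ U,
      ∃ (a : Ainf (p := p) F) (w : BDeRhamPlus (integerC F) p),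
        galBdRPlus τ b - b = ainfToBdR ((p : Ainf (p := p) F) ^ N * a) + xiBdR ^ k * w := by
  obtain ⟨r, a₀, w₀, hb⟩ := exists_natCast_pow_mul_eq_ainfToBdR_add b k
  obtain ⟨U, hU⟩ := exists_openSubgroup_galAinf_sub_mem_span a₀ (N + r) k
  obtain ⟨q, hq⟩ := exists_mul_natCast_pow_eq_one (F := F) (p := p) r
  refine ⟨U, fun τ hτ => ?_⟩
  obtain ⟨c, d, hcd⟩ := Ideal.mem_span_pair.1 (hU τ hτ)
  obtain ⟨w₁, hw₁⟩ := exists_galBdRPlus_xiBdR_pow_mul τ k w₀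
  refine ⟨d, q * (ainfToBdR c + w₁ - w₀), ?_⟩
  have h2 : galBdRPlus τ ((p : BDeRhamPlus (integerC F) p) ^ r * b) = ainfToBdR (galAinf τ a₀) + xiBdR ^ k * w₁ := by
    rw [hb, map_add, galBdRPlus_ainfToBdR, hw₁]
  rw [map_mul, map_pow, map_natCast] at h2
  have h1 : (p : BDeRhamPlus (integerC F) p) ^ r * (galBdRPlus τ b - b) =
      ainfToBdR (galAinf τ a₀ - a₀) + (xiBdR ^ k * w₁ - xiBdR ^ k * w₀) := by
    rw [mul_sub, h2, hb, map_sub]; ring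
  rw [← hcd, map_add, map_mul, map_mul, map_pow, map_pow, ainfToBdR_xi, map_natCast] at h1
  have h3 : galBdRPlus τ b - b = q * ((p : BDeRhamPlus (integerC F) p) ^ r * (galBdRPlus τ b - b)) := by
    rw [← mul_assoc, hq, one_mul]
  rw [h3, h1, map_mul, map_pow, map_natCast, pow_add]
  linear_combination ((p : BDeRhamPlus (integerC F) p) ^ N * ainfToBdR d) * hq

/-- The same with a base point: `σ τ b − σ b ∈ Λ(N,k)` for `τ ∈ U`, uniformly in `σ` (apply `σ`, which maps
`ι(𝔸_inf)`, `p` and `(ξ^k)` into themselves). [cite: FontaineAsterisque223III, Exp. II §1.5.3–1.5.5] -/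
theorem exists_openSubgroup_galBdRPlus_mul_sub_mem (b : BDeRhamPlus (integerC F) p) (N k : ℕ) :
    ∃ U : OpenSubgroup (absoluteGaloisGroup F), ∀ σ : absoluteGaloisGroup F, ∀ τ ∈ U,
      ∃ (a : Ainf (p := p) F) (w : BDeRhamPlus (integerC F) p),
        galBdRPlus (σ * τ) b - galBdRPlus σ b = ainfToBdR ((p : Ainf (p := p) F) ^ N * a) + xiBdR ^ k * w := by
  obtain ⟨U, hU⟩ := exists_openSubgroup_galBdRPlus_sub_mem b N k
  refine ⟨U, fun σ τ hτ => ?_⟩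
  obtain ⟨a, w, haw⟩ := hU τ hτ
  obtain ⟨w', hw'⟩ := exists_galBdRPlus_xiBdR_pow_mul σ k w
  refine ⟨galAinf σ a, w', ?_⟩
  rw [galBdRPlus_mul, ← map_sub, haw, map_add, galBdRPlus_ainfToBdR, hw', map_mul, map_pow, map_natCast]

/-! ## §4 The lattices are `θ`-small -/

/-- **`θ(ι(p^N a) + ξ^k w) = p^N θ(a)` has norm `≤ ‖p‖^N`** (`k ≥ 1`; `θ(𝔸_inf) = 𝒪_{ℂ_F}`): the projection
`θ : B_dR⁺ → ℂ_F` is continuous for Fontaine's topology. [cite: FontaineAsterisque223III, Exp. II §1.5.3–1.5.5] -/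
theorem norm_thetaBdR_le_of_eq {x : BDeRhamPlus (integerC F) p} {N k : ℕ} (hk : k ≠ 0) {a : Ainf (p := p) F}
    {w : BDeRhamPlus (integerC F) p} (hx : x = ainfToBdR ((p : Ainf (p := p) F) ^ N * a) + xiBdR ^ k * w) :
    ‖thetaBdR x‖ ≤ ‖(p : CompletedAlgClosure F)‖ ^ N := by
  rw [hx, map_add, map_mul thetaBdR (xiBdR ^ k), map_pow, thetaBdR_xiBdR, zero_pow hk, zero_mul, add_zero,
    thetaBdR_ainfToBdR, map_mul, map_pow, map_natCast]
  push_cast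
  rw [norm_mul, norm_pow]
  exact mul_le_of_le_one_right (pow_nonneg (norm_nonneg _) _) (norm_coe_integerC_le _)

/-! ## §5 Scalar tools: uniform continuity along open subgroups; small elements of `ℚ_p` -/

omit [ValuativeRel F] [TopologicalSpace F] [IsNonarchimedeanLocalField F] [Fact p.Prime]
  [Fact (¬ IsUnit (p : integerC F))] [IsAdicComplete (Ideal.span {(p : integerC F)}) (integerC F)] in
/-- **A continuous map on the compact group `Γ_F` is uniformly continuous along open subgroups**: for
`f : Γ_F → X` continuous (`X` pseudo-metric) and `ε > 0` there is an open subgroup `U` with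
`dist (f(στ)) (f σ) < ε` for all `σ` and all `τ ∈ U` (tube lemma + the Krull topology has a basis of open
subgroups). [folklore] [cite: SerreLocalFields1979, Ch. VII §5] -/
theorem exists_openSubgroup_dist_lt {X : Type*} [PseudoMetricSpace X] {f : absoluteGaloisGroup F → X}
    (hf : Continuous f) {ε : ℝ} (hε : 0 < ε) :
    ∃ U : OpenSubgroup (absoluteGaloisGroup F), ∀ σ : absoluteGaloisGroup F, ∀ τ ∈ U,
      dist (f (σ * τ)) (f σ) < ε := by
  have hP : ∀ σ ∈ (Set.univ : Set (absoluteGaloisGroup F)),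
      ∀ᶠ z : absoluteGaloisGroup F × absoluteGaloisGroup F in 𝓝 ((1 : absoluteGaloisGroup F), σ),
        dist (f (z.2 * z.1)) (f z.2) < ε := by
    intro σ _
    have hc : Continuous fun z : absoluteGaloisGroup F × absoluteGaloisGroup F => dist (f (z.2 * z.1)) (f z.2) :=
      (hf.comp (continuous_snd.mul continuous_fst)).dist (hf.comp continuous_snd)
    have h0 : dist (f (((1 : absoluteGaloisGroup F), σ).2 * ((1 : absoluteGaloisGroup F), σ).1))
        (f ((1 : absoluteGaloisGroup F), σ).2) < ε := by
      rw [mul_one, dist_self]; exact hε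
    exact (hc.tendsto _).eventually (eventually_lt_nhds h0)
  have h := IsCompact.eventually_forall_of_forall_eventually
    (P := fun τ σ => dist (f (σ * τ)) (f σ) < ε) isCompact_univ hP
  obtain ⟨E, hfin, hE⟩ := (krullTopology_mem_nhds_one_iff F (AlgebraicClosure F) _).mp h
  haveI := hfin
  exact ⟨⟨E.fixingSubgroup, E.fixingSubgroup_isOpen⟩, fun σ τ hτ => hE hτ σ (Set.mem_univ σ)⟩

omit [ValuativeRel F] [TopologicalSpace F] [IsNonarchimedeanLocalField F] [CharZero F]
  [Fact (¬ IsUnit (p : integerC F))] [IsAdicComplete (Ideal.span {(p : integerC F)}) (integerC F)] in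
/-- `‖x‖ ≤ p^{-n}` in `ℚ_p` means `x = p^n g` with `g ∈ ℤ_p`. [folklore] -/
private theorem exists_eq_natCast_pow_mul_coe_of_norm_le {x : ℚ_[p]} {n : ℕ} (hx : ‖x‖ ≤ (p : ℝ) ^ (-(n : ℤ))) :
    ∃ g : ℤ_[p], x = (p : ℚ_[p]) ^ n * (g : ℚ_[p]) := by
  have hp0 : (p : ℚ_[p]) ≠ 0 := Nat.cast_ne_zero.2 (Fact.out : p.Prime).ne_zero
  have hy : ‖x / (p : ℚ_[p]) ^ n‖ ≤ 1 := by
    rw [norm_div, Padic.norm_p_pow, div_le_one (zpow_pos (Nat.cast_pos.2 (Fact.out : p.Prime).pos) _)]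
    exact hx
  refine ⟨⟨x / (p : ℚ_[p]) ^ n, hy⟩, ?_⟩
  change x = (p : ℚ_[p]) ^ n * (x / (p : ℚ_[p]) ^ n)
  rw [mul_div_cancel₀ _ (pow_ne_zero _ hp0)]

omit [ValuativeRel F] [TopologicalSpace F] [IsNonarchimedeanLocalField F]
  [Fact (¬ IsUnit (p : integerC F))] [IsAdicComplete (Ideal.span {(p : integerC F)}) (integerC F)] in
/-- **Continuous scalar functions are uniformly locally constant modulo `p^n`**: for `f : Γ_F → ℚ_p` continuous
and `n`, there is an open subgroup `U` with `f(στ) − f(σ) ∈ p^n ℤ_p` for all `σ`, `τ ∈ U`.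
[folklore] [cite: SerreLocalFields1979, Ch. VII §5] -/
theorem exists_openSubgroup_sub_eq_natCast_pow_mul {f : absoluteGaloisGroup F → ℚ_[p]} (hf : Continuous f) (n : ℕ) :
    ∃ U : OpenSubgroup (absoluteGaloisGroup F), ∀ σ : absoluteGaloisGroup F, ∀ τ ∈ U,
      ∃ g : ℤ_[p], f (σ * τ) - f σ = (p : ℚ_[p]) ^ n * (g : ℚ_[p]) := by
  have hε : (0 : ℝ) < (p : ℝ) ^ (-(n : ℤ)) := zpow_pos (Nat.cast_pos.2 (Fact.out : p.Prime).pos) _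
  obtain ⟨U, hU⟩ := exists_openSubgroup_dist_lt hf hε
  refine ⟨U, fun σ τ hτ => exists_eq_natCast_pow_mul_coe_of_norm_le ?_⟩
  rw [← dist_eq_norm]
  exact (hU σ τ hτ).le

/-! ## §6 Lattice algebra: `Λ(N,k) = p^N ι(𝔸_inf) + ξ^k B_dR⁺` is a filtered family of `𝔸_inf`-submodules -/

omit [CharZero F] in
/-- `Λ(N', k') ⊆ Λ(N, k)` for `N ≤ N'`, `k ≤ k'`. [cite: FontaineAsterisque223III, Exp. II §1.5.3] -/
theorem lattice_mono {x : BDeRhamPlus (integerC F) p} {N N' k k' : ℕ} (hN : N ≤ N') (hk : k ≤ k')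
    {a : Ainf (p := p) F} {w : BDeRhamPlus (integerC F) p}
    (hx : x = ainfToBdR ((p : Ainf (p := p) F) ^ N' * a) + xiBdR ^ k' * w) :
    ∃ (a' : Ainf (p := p) F) (w' : BDeRhamPlus (integerC F) p),
      x = ainfToBdR ((p : Ainf (p := p) F) ^ N * a') + xiBdR ^ k * w' := by
  obtain ⟨i, rfl⟩ := Nat.exists_eq_add_of_le hN
  obtain ⟨j, rfl⟩ := Nat.exists_eq_add_of_le hk
  refine ⟨(p : Ainf (p := p) F) ^ i * a, xiBdR ^ j * w, ?_⟩
  rw [hx, pow_add, pow_add]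
  simp only [map_mul, map_pow, map_natCast]
  ring

omit [CharZero F] in
/-- `Λ(N, k)` is closed under addition. [cite: FontaineAsterisque223III, Exp. II §1.5.3] -/
theorem lattice_add {x y : BDeRhamPlus (integerC F) p} {N k : ℕ} {a b : Ainf (p := p) F}
    {v w : BDeRhamPlus (integerC F) p}
    (hx : x = ainfToBdR ((p : Ainf (p := p) F) ^ N * a) + xiBdR ^ k * v)
    (hy : y = ainfToBdR ((p : Ainf (p := p) F) ^ N * b) + xiBdR ^ k * w) :
    x + y = ainfToBdR ((p : Ainf (p := p) F) ^ N * (a + b)) + xiBdR ^ k * (v + w) := by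
  rw [hx, hy, mul_add, map_add]; ring

omit [CharZero F] in
/-- `Λ(N, k)` is closed under subtraction. [cite: FontaineAsterisque223III, Exp. II §1.5.3] -/
theorem lattice_sub {x y : BDeRhamPlus (integerC F) p} {N k : ℕ} {a b : Ainf (p := p) F}
    {v w : BDeRhamPlus (integerC F) p}
    (hx : x = ainfToBdR ((p : Ainf (p := p) F) ^ N * a) + xiBdR ^ k * v)
    (hy : y = ainfToBdR ((p : Ainf (p := p) F) ^ N * b) + xiBdR ^ k * w) :
    x - y = ainfToBdR ((p : Ainf (p := p) F) ^ N * (a - b)) + xiBdR ^ k * (v - w) := by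
  rw [hx, hy, mul_sub, map_sub]; ring

omit [CharZero F] in
/-- `Λ(N, k)` is an `𝔸_inf`-submodule: `ι(c) · Λ(N,k) ⊆ Λ(N,k)`. [cite: FontaineAsterisque223III, Exp. II §1.5.3] -/
theorem lattice_ainfToBdR_mul {x : BDeRhamPlus (integerC F) p} {N k : ℕ} {a : Ainf (p := p) F}
    {w : BDeRhamPlus (integerC F) p} (c : Ainf (p := p) F)
    (hx : x = ainfToBdR ((p : Ainf (p := p) F) ^ N * a) + xiBdR ^ k * w) :
    ainfToBdR c * x = ainfToBdR ((p : Ainf (p := p) F) ^ N * (c * a)) + xiBdR ^ k * (ainfToBdR c * w) := by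
  rw [hx, map_mul, map_mul, map_mul]; ring

omit [CharZero F] in
/-- `ℤ_p · Λ(N,k) ⊆ Λ(N,k)` (`ℤ_p ⊆ 𝔸_inf`, `qpToBdR` extends `ℤ_p → 𝔸_inf → B_dR⁺`). [cite: FontaineAsterisque223III, Exp. II §1.5.3] -/
theorem lattice_qpToBdR_coe_mul {x : BDeRhamPlus (integerC F) p} {N k : ℕ} {a : Ainf (p := p) F}
    {w : BDeRhamPlus (integerC F) p} (g : ℤ_[p])
    (hx : x = ainfToBdR ((p : Ainf (p := p) F) ^ N * a) + xiBdR ^ k * w) :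
    qpToBdR (g : ℚ_[p]) * x =
      ainfToBdR ((p : Ainf (p := p) F) ^ N * (zpToAinf g * a)) + xiBdR ^ k * (qpToBdR (g : ℚ_[p]) * w) := by
  rw [qpToBdR_coe]
  exact lattice_ainfToBdR_mul (zpToAinf g) hx

omit [CharZero F] in
/-- **Multiplication by a bounded element**: if `p^r b = ι(a_b) + ξ^k w_b` and `x ∈ Λ(N + r, k)` then
`b x ∈ Λ(N, k)` — multiplication by a fixed `b ∈ B_dR⁺` is continuous. [cite: FontaineAsterisque223III, Exp. II §1.5.3] -/
theorem lattice_mul_of_bounded {b x : BDeRhamPlus (integerC F) p} {r N k : ℕ} {ab a : Ainf (p := p) F}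
    {wb w : BDeRhamPlus (integerC F) p}
    (hb : (p : BDeRhamPlus (integerC F) p) ^ r * b = ainfToBdR ab + xiBdR ^ k * wb)
    (hx : x = ainfToBdR ((p : Ainf (p := p) F) ^ (N + r) * a) + xiBdR ^ k * w) :
    ∃ (a' : Ainf (p := p) F) (w' : BDeRhamPlus (integerC F) p),
      b * x = ainfToBdR ((p : Ainf (p := p) F) ^ N * a') + xiBdR ^ k * w' := by
  refine ⟨ab * a, wb * ainfToBdR ((p : Ainf (p := p) F) ^ N * a) + b * w, ?_⟩
  have h1 : b * ainfToBdR ((p : Ainf (p := p) F) ^ (N + r) * a) =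
      ((p : BDeRhamPlus (integerC F) p) ^ r * b) * ainfToBdR ((p : Ainf (p := p) F) ^ N * a) := by
    simp only [pow_add, map_mul, map_pow, map_natCast]; ring
  rw [hx, mul_add, h1, hb]
  simp only [map_mul, map_pow, map_natCast]
  ring

omit [CharZero F] in
/-- **A small scalar times a bounded element is small**: if `p^r y = ι(a) + ξ^k w` and `δ = p^{N+r} g` with
`g ∈ ℤ_p` then `δ · y ∈ Λ(N, k)` — continuity of scalar multiplication `ℚ_p × B_dR⁺ → B_dR⁺`.
[cite: FontaineAsterisque223III, Exp. II §1.5.3] -/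
theorem lattice_smul_of_bounded {y : BDeRhamPlus (integerC F) p} {r N k : ℕ} {a : Ainf (p := p) F}
    {w : BDeRhamPlus (integerC F) p} {δ : ℚ_[p]} {g : ℤ_[p]}
    (hy : (p : BDeRhamPlus (integerC F) p) ^ r * y = ainfToBdR a + xiBdR ^ k * w)
    (hδ : δ = (p : ℚ_[p]) ^ (N + r) * (g : ℚ_[p])) :
    ∃ (a' : Ainf (p := p) F) (w' : BDeRhamPlus (integerC F) p),
      qpToBdR δ * y = ainfToBdR ((p : Ainf (p := p) F) ^ N * a') + xiBdR ^ k * w' := by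
  refine ⟨zpToAinf g * a, qpToBdR ((p : ℚ_[p]) ^ N * (g : ℚ_[p])) * w, ?_⟩
  have h1 : qpToBdR δ * y =
      qpToBdR ((p : ℚ_[p]) ^ N * (g : ℚ_[p])) * ((p : BDeRhamPlus (integerC F) p) ^ r * y) := by
    rw [hδ, pow_add]
    simp only [map_mul, map_pow, map_natCast]
    ring
  rw [h1, hy, mul_add, map_mul, map_pow, map_natCast, qpToBdR_coe]
  simp only [map_mul, map_pow, map_natCast]
  ring

end GaloisContinuity

end Literature.NumberTheory.PAdicHodge

end
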